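import Literature.MathematicalPhysics.KineticTheory.InfiniteChainGibbsExistenceShift
import Literature.MathematicalPhysics.KineticTheory.InfiniteChainShiftInvariantUniqueness
import Literature.MathematicalPhysics.KineticTheory.InfiniteChainGibbsInvariance
import Literature.MathematicalPhysics.KineticTheory.InfiniteChainSuperstableReversal
import Literature.MathematicalPhysics.KineticTheory.InfiniteChainGoodSetSymmetries
import Literature.MathematicalPhysics.KineticTheory.InfiniteChainCurrentPositiveType
import Literature.MathematicalPhysics.KineticTheory.InfiniteChainL2Locality
import Literature.MathematicalPhysics.KineticTheory.InfiniteChainSeveredGibbs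
import Literature.MathematicalPhysics.KineticTheory.InfiniteChainPartialMomentumReversal
import Literature.MathematicalPhysics.KineticTheory.InfiniteChainCurrentMoments
import Literature.MathematicalPhysics.KineticTheory.InfiniteChainGeneratorLipschitz
import Literature.MathematicalPhysics.KineticTheory.InfiniteChainCovarianceMixingBox
import Literature.MathematicalPhysics.KineticTheory.ChainMixingClustering

/-!
# Stub `stub_infiniteVolumeWitness` (WIT) of line `drude-controls-conductance` (R2) — crux
`JunctionLocality.NonBallistic` (stmt-AtomisticToContinuum-9127)

Helper file (`--supports stmt-AtomisticToContinuum-9127`); nothing here closes the item.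

At every temperature `T > 0` the infinite pinned anharmonic chain `P = pinnedChain ω₂ lam β γ`
(all parameters `> 0`) has an ADMISSIBLE infinite-volume pair `(μ, D)`:

* `μ` is the shift-invariant DLR Gibbs state at `T`
  (`exists_isChainGibbsMeasure_shiftInvariant_superstable_pinnedChain`), which is invariant under
  the momentum reversal `(q, p) ↦ (q, -p)` because the shift-invariant DLR state is unique
  (`eq_of_isChainGibbsMeasure_of_isShiftInvariant_pinnedChain`,
  `map_momentumReversalZ_eq_of_regular_unique`);
* `D` is a Buttà–Marchioro dynamics (`OscillatorChain.exists_bmDynamics`): carrier `𝒳₀ = bmGood P`,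
  preserving every superstable DLR state, commuting with the lattice translations a.e.
  (`flow_comp_chainShift_ae_of_carrier_eq_bmGood`);
* the only real content, **absolute convergence of the current correlation sum at every fixed
  time** `Σ_x |∫ j_0 (j_x ∘ φ_t) dμ| < ∞` (`summable_abs_correlationTerm_of_carrier_eq_bmGood`, for
  any chain with even polynomial `U`, `V` and any dynamics with carrier `𝒳₀` preserving a
  shift-invariant superstable DLR state): by shift covariance
  `∫ j_0 (j_x ∘ φ_t) dμ = ∫ j_{-x} (j_0 ∘ φ_t) dμ` (`integral_bondCurrentZ_mul_flow_eq_of_shift`); by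
  the fixed-time `L²` locality with summable rate (`exists_summable_l2_locality`) `j_0 ∘ φ_t` is
  within `ε_n` in `L²(μ)` of the local approximant `g_n = j_0 ∘ T^{Λ_{0,n}}_t`, which reads the
  sites of `[-n-1, n+1]` only; for `n = |x| - 3` the momenta `p_{-x}, p_{-x+1}` of
  `j_{-x} = -½ (p_{-x} + p_{-x+1}) V'(q_{-x+1} - q_{-x})` are not read by `g_n`, so `j_{-x} g_n` is
  ODD under the partial momentum reversal `R_{{-x, -x+1}}`, which preserves every DLR state
  (`IsChainGibbsMeasure.map_momentumReversalOn`): `∫ j_{-x} g_n dμ = 0` EXACTLY, whence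
  `|∫ j_0 (j_x ∘ φ_t) dμ| ≤ ‖j_0‖_{L²(μ)} ε_{|x|-3}` (Cauchy–Schwarz), summable over `x ∈ ℤ`.
  The integrability clause is `hasAbsConvergentCorrelation_integrable_pinnedChain`.
-/

noncomputable section

namespace Summit.AtomisticToContinuum.FouriersLaw.Theorems.NonBallistic

open MeasureTheory ProbabilityTheory Filter Topology Set Function
open scoped NNReal ENNReal BigOperators
open Literature.MathematicalPhysics.KineticTheory
open Literature.MathematicalPhysics.KineticTheory.HeatConduction

/-- The bond current `j_0` reads the sites `0, 1` only, hence depends on the sites of `[-1, 1]`.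
[folklore] -/
theorem dependsOn_bondCurrentZ_zero_Icc (P : OscillatorChain) :
    DependsOn (fun σ : ChainConfig => P.bondCurrentZ σ 0) (Icc (-1 : ℤ) 1) := by
  intro σ σ' h
  have h0 : σ 0 = σ' 0 := h 0 ⟨by norm_num, by norm_num⟩
  have h1 : σ (0 + 1) = σ' (0 + 1) := h (0 + 1) ⟨by norm_num, by norm_num⟩
  simp only [OscillatorChain.bondCurrentZ, h0, h1]

/-- **Orthogonality of a far bond current to a local observable, under any DLR state.** If `g`
depends on the sites of `[-n-1, n+1]` only and the bond `-x` lies outside, `3 ≤ |x|` and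
`n = |x| - 3`, then `∫ j_{-x} · g dμ = 0` for every DLR state `μ` (the integrand is odd under the
partial momentum reversal `R_{{-x, -x+1}}`, which preserves `μ`; no integrability is needed). [folklore] -/
theorem integral_bondCurrentZ_neg_mul_eq_zero_of_dependsOn {P : OscillatorChain} {T : ℝ}
    {μ : Measure ChainConfig} (hG : P.IsChainGibbsMeasure T μ) {x : ℤ} (hx : 3 ≤ x.natAbs)
    {g : ChainConfig → ℝ} (hg : DependsOn g (Icc (-((x.natAbs - 3 : ℕ) : ℤ) - 1) ((x.natAbs - 3 : ℕ) + 1))) :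
    ∫ σ, P.bondCurrentZ σ (-x) * g σ ∂μ = 0 := by
  refine integral_eq_zero_of_momentumReversalOn_odd (hG.map_momentumReversalOn {-x, -x + 1})
    fun σ => ?_
  have hgR : g (momentumReversalOn {-x, -x + 1} σ) = g σ := by
    refine hg fun i hi => momentumReversalOn_apply_not_mem σ fun hiS => ?_
    rw [Set.mem_Icc] at hi
    simp only [Finset.mem_insert, Finset.mem_singleton] at hiS
    omega
  rw [P.bondCurrentZ_momentumReversalOn_of_mem σ (by simp) (by simp), hgR]
  ring

/-- **Absolute convergence of the current correlation sum at a fixed time, BM class.** Let `U`, `V`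
be even non-negative polynomials of degrees `2s₁, 2s₂ ≥ 2`, `μ` a shift-invariant DLR state with
Buttà–Marchioro's superstability estimate (2.3), and `D` a dynamics with carrier `𝒳₀` preserving
`μ`. Then `Σ_x |∫ j_0 (j_x ∘ φ_t) dμ| < ∞` for every `t`: shift covariance, `L²` locality of
`j_0 ∘ φ_t` with summable rate, and exact orthogonality of `j_{-x}` to the local approximant
(partial momentum reversal). [folklore] -/
theorem summable_abs_correlationTerm_of_carrier_eq_bmGood {P : OscillatorChain} {s₁ s₂ : ℕ}
    (hs₁ : 1 ≤ s₁) (hs₂ : 1 ≤ s₂) (hU1 : OscillatorChain.IsEvenPolyOfDegree P.U s₁)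
    (hV1 : OscillatorChain.IsEvenPolyOfDegree P.V s₂) {T : ℝ} {μ : Measure ChainConfig}
    (hG : P.IsChainGibbsMeasure T μ) (hS : IsShiftInvariant μ)
    (hss : P.HasSuperstabilityEstimate μ) (D : InfiniteChainDynamics P)
    (hcar : D.carrier = P.bmGood) (hD : D.PreservesMeasure μ) (t : ℝ) :
    Summable fun x : ℤ => |∫ σ, P.bondCurrentZ σ 0 * P.bondCurrentZ (D.flow t σ) x ∂μ| := by
  haveI : IsProbabilityMeasure μ := hss.1
  -- the chain data
  have hU0 : ∀ r, 0 ≤ P.U r := hU1.choose_spec.2.2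
  have hV0 : ∀ r, 0 ≤ P.V r := hV1.choose_spec.2.2
  have hU : ContDiff ℝ 2 P.U := hU1.contDiff_two
  have hV : ContDiff ℝ 2 P.V := hV1.contDiff_two
  have hUm : Measurable P.U := hU.continuous.measurable
  have hB1 : P.CondB1 :=
    OscillatorChain.condB1_of_bddBelow _ hU hV ⟨0, by rintro _ ⟨q, rfl⟩; exact hU0 q⟩
      ⟨0, by rintro _ ⟨r, rfl⟩; exact hV0 r⟩
  -- moments of the bond currents
  have hj2 : ∀ x : ℤ, MemLp (fun σ => P.bondCurrentZ σ x) 2 μ := fun x =>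
    hss.memLp_bondCurrentZ hs₂ hU0 hUm hV1 x ENNReal.ofNat_ne_top
  have hj4' : MemLp (fun σ => P.bondCurrentZ σ 0) 4 μ :=
    hss.memLp_bondCurrentZ hs₂ hU0 hUm hV1 0 ENNReal.ofNat_ne_top
  have hj4 : Integrable (fun σ => P.bondCurrentZ σ 0 ^ 4) μ := by
    have h := hj4'.integrable_norm_pow' (p := 4)
    refine h.congr (Eventually.of_forall fun σ => ?_)
    simp only [Real.norm_eq_abs]
    exact Even.pow_abs (by decide) _
  -- the severed flows preserve the DLR state (LLL 1977 §4 (i))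
  have hsev : ∀ (n : ℕ) (t : ℝ), MeasurePreserving
      (OscillatorChain.severedFlow hB1 (Finset.Icc ((0 : ℤ) - n) ((0 : ℤ) + n)) t) μ μ := fun n t =>
    OscillatorChain.measurePreserving_severedFlow_of_isChainGibbsMeasure hU hV hB1 _ hG t
  -- `L²` locality of `j_0 ∘ φ_t` with summable rate
  obtain ⟨Ca, hCa, hL⟩ := OscillatorChain.exists_polyLipschitz_bondCurrentZ hV1
  obtain ⟨ε, hε0, hε, hmain⟩ := D.exists_summable_l2_locality hs₁ hs₂ hU1 hV1 hcar hB1 hss hD hsev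
    (measurable_bondCurrentZ P 0) (dependsOn_bondCurrentZ_zero_Icc P) (hj2 0) hj4 hCa hL |t|
    (abs_nonneg t)
  -- uniform bound on the terms
  obtain ⟨B, hB0, hB⟩ := D.exists_abs_integral_bondCurrentZ_mul_bondCurrentZ_flow_le hss hs₂ hU0
    hUm hV1 hD
  -- a.e. shift covariance of the flow
  have hcomm : ∀ (t : ℝ) (x : ℤ), D.flow t ∘ chainShift x =ᵐ[μ] chainShift x ∘ D.flow t :=
    fun t x => D.flow_comp_chainShift_ae_of_carrier_eq_bmGood hcar hU0 hV0 hD.1 t x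
  -- the key estimate for `3 ≤ |x|`
  have hkey : ∀ x : ℤ, 3 ≤ x.natAbs →
      |∫ σ, P.bondCurrentZ σ 0 * P.bondCurrentZ (D.flow t σ) x ∂μ| ≤
        Real.sqrt (∫ σ, P.bondCurrentZ σ 0 ^ 2 ∂μ) * ε (x.natAbs - 3) := by
    intro x hx
    obtain ⟨hdep, -, hg2, hrate⟩ := hmain t le_rfl (x.natAbs - 3)
    set g : ChainConfig → ℝ := (fun σ => P.bondCurrentZ σ 0) ∘
      OscillatorChain.severedFlow hB1 (Finset.Icc ((0 : ℤ) - (x.natAbs - 3 : ℕ))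
        ((0 : ℤ) + (x.natAbs - 3 : ℕ))) t with hgdef
    -- shift covariance: `∫ j_0 (j_x ∘ φ_t) = ∫ j_{-x} (j_0 ∘ φ_t)`
    have hA : ∫ σ, P.bondCurrentZ σ 0 * P.bondCurrentZ (D.flow t σ) x ∂μ =
        ∫ σ, P.bondCurrentZ σ (-x) * P.bondCurrentZ (D.flow t σ) 0 ∂μ := by
      rw [D.integral_bondCurrentZ_mul_flow_eq_of_shift hD hS hcomm t (-x) 0, sub_neg_eq_add, zero_add]
    -- orthogonality: `∫ j_{-x} g = 0`
    have hC : ∫ σ, P.bondCurrentZ σ (-x) * g σ ∂μ = 0 :=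
      integral_bondCurrentZ_neg_mul_eq_zero_of_dependsOn hG hx hdep
    -- integrability of the two products
    have hφ2 : MemLp (fun σ => P.bondCurrentZ (D.flow t σ) 0) 2 μ :=
      (hj2 0).comp_measurePreserving (hD.2 t)
    have hint1 : Integrable (fun σ => P.bondCurrentZ σ (-x) * P.bondCurrentZ (D.flow t σ) 0) μ :=
      (hj2 (-x)).integrable_mul hφ2
    have hint2 : Integrable (fun σ => P.bondCurrentZ σ (-x) * g σ) μ := (hj2 (-x)).integrable_mul hg2
    have hdiff : ∫ σ, P.bondCurrentZ σ (-x) * P.bondCurrentZ (D.flow t σ) 0 ∂μ =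
        ∫ σ, P.bondCurrentZ σ (-x) * (P.bondCurrentZ (D.flow t σ) 0 - g σ) ∂μ := by
      have e : ∫ σ, P.bondCurrentZ σ (-x) * P.bondCurrentZ (D.flow t σ) 0 ∂μ =
          (∫ σ, P.bondCurrentZ σ (-x) * P.bondCurrentZ (D.flow t σ) 0 ∂μ) -
            ∫ σ, P.bondCurrentZ σ (-x) * g σ ∂μ := by rw [hC, sub_zero]
      rw [e, ← integral_sub hint1 hint2]
      refine integral_congr_ae (Eventually.of_forall fun σ => ?_)
      simp only
      ring
    -- Cauchy–Schwarz
    have hm : MemLp (fun σ => P.bondCurrentZ (D.flow t σ) 0 - g σ) 2 μ := hφ2.sub hg2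
    have hCS := abs_integral_mul_le_sqrt_integral_sq_mul (hj2 (-x)) hm
    -- `∫ j_{-x}² = ∫ j_0²` by shift invariance
    have hJx : ∫ σ, P.bondCurrentZ σ (-x) ^ 2 ∂μ = ∫ σ, P.bondCurrentZ σ 0 ^ 2 ∂μ := by
      have h := integral_sq_comp_eq' (hS.measurePreserving_chainShift (-x)) (measurable_bondCurrentZ P 0)
      simp only [OscillatorChain.bondCurrentZ_chainShift, zero_add] at h
      exact h
    have hrate' : Real.sqrt (∫ σ, (P.bondCurrentZ (D.flow t σ) 0 - g σ) ^ 2 ∂μ) ≤ ε (x.natAbs - 3) := by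
      simpa only [hgdef, comp_apply] using hrate
    calc |∫ σ, P.bondCurrentZ σ 0 * P.bondCurrentZ (D.flow t σ) x ∂μ|
        = |∫ σ, P.bondCurrentZ σ (-x) * (P.bondCurrentZ (D.flow t σ) 0 - g σ) ∂μ| := by rw [hA, hdiff]
      _ ≤ Real.sqrt (∫ σ, P.bondCurrentZ σ (-x) ^ 2 ∂μ) *
            Real.sqrt (∫ σ, (P.bondCurrentZ (D.flow t σ) 0 - g σ) ^ 2 ∂μ) := hCS
      _ ≤ Real.sqrt (∫ σ, P.bondCurrentZ σ 0 ^ 2 ∂μ) * ε (x.natAbs - 3) := by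
          rw [hJx]
          exact mul_le_mul_of_nonneg_left hrate' (Real.sqrt_nonneg _)
  -- the summable majorant `Φ(|x|)`
  set J : ℝ := Real.sqrt (∫ σ, P.bondCurrentZ σ 0 ^ 2 ∂μ) with hJ
  have hΦ : Summable fun m : ℕ => if m < 3 then B else J * ε (m - 3) := by
    refine (summable_nat_add_iff 3).1 ?_
    have e : (fun m : ℕ => if m + 3 < 3 then B else J * ε (m + 3 - 3)) = fun m => J * ε m := by
      funext m
      have h1 : ¬ (m + 3 < 3) := by omega
      simp only [h1, if_false, Nat.add_sub_cancel]
    rw [e]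
    exact hε.mul_left J
  refine Summable.of_nonneg_of_le (fun x => abs_nonneg _) (fun x => ?_) (summable_int_comp_natAbs hΦ)
  by_cases hx : x.natAbs < 3
  · simp only [hx, if_true]
    exact hB t x 0
  · simp only [hx, if_false]
    exact hkey x (not_lt.1 hx)

/-- **Stub `stub_infiniteVolumeWitness`** (WIT, registered stub 8 of line `drude-controls-conductance`,
R2; harmonic-true): at every `T > 0` the infinite pinned chain `pinnedChain ω₂ lam β γ` (all
parameters `> 0`) has an ADMISSIBLE PAIR — the shift-invariant, momentum-reversal-invariant DLR
Gibbs state `μ` at `T` and a Buttà–Marchioro dynamics `D` (carrier `𝒳₀ = bmGood`, preserving `μ`,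
commuting with the unit shift a.e.) whose current correlations converge ABSOLUTELY at every time,
`Σ_x |∫ j_0 (j_x ∘ φ_t) dμ| < ∞` (`summable_abs_correlationTerm_of_carrier_eq_bmGood`).
[cite: ButtaMarchioro2016, §2 Thm 2.1 and §3] -/
theorem stub_infiniteVolumeWitness :
    ∀ ω₂ lam β γ : ℝ, 0 < ω₂ → 0 < lam → 0 < β → 0 < γ → ∀ T : ℝ, 0 < T →
      ∃ (μ : Measure ChainConfig) (D : InfiniteChainDynamics (pinnedChain ω₂ lam β γ)),
        (pinnedChain ω₂ lam β γ).IsChainGibbsMeasure T μ ∧ IsShiftInvariant μ ∧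
        μ.map (fun σ : ChainConfig => fun x : ℤ => ((σ x).1, -(σ x).2)) = μ ∧
        D.carrier ⊆ (pinnedChain ω₂ lam β γ).bmGood ∧ D.PreservesMeasure μ ∧
        (∀ t : ℝ, ∀ᵐ σ ∂μ, D.flow t (shift σ) = shift (D.flow t σ)) ∧
        (∀ t : ℝ, D.HasAbsConvergentCorrelation μ t) := by
  intro ω₂ lam β γ hω hl hβ _hγ T hT
  -- the chain data
  have hU1 : OscillatorChain.IsEvenPolyOfDegree (pinnedChain ω₂ lam β γ).U 2 :=
    OscillatorChain.pinnedChain_isEvenPolyOfDegree_U β γ hω.le hl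
  have hV1 : OscillatorChain.IsEvenPolyOfDegree (pinnedChain ω₂ lam β γ).V 2 :=
    OscillatorChain.pinnedChain_isEvenPolyOfDegree_V ω₂ lam γ hβ
  have hU0 : ∀ r, 0 ≤ (pinnedChain ω₂ lam β γ).U r := hU1.choose_spec.2.2
  have hV0 : ∀ r, 0 ≤ (pinnedChain ω₂ lam β γ).V r := hV1.choose_spec.2.2
  -- the state: the shift-invariant superstable DLR state at `T`
  obtain ⟨μ, hG, hS, hss⟩ :=
    OscillatorChain.exists_isChainGibbsMeasure_shiftInvariant_superstable_pinnedChain γ hω hl.le hβ.le hT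
  -- the dynamics: Buttà–Marchioro, carrier `𝒳₀`
  obtain ⟨D, hcar, -, -, -, -, -, hpres⟩ := OscillatorChain.exists_bmDynamics (P := pinnedChain ω₂ lam β γ)
    (by norm_num) (by norm_num) hU1 hV1
  have hD : D.PreservesMeasure μ := hpres T μ hG hss
  -- uniqueness in the regular class, hence reversal invariance
  have huniq : ∀ μ₁ μ₂ : Measure ChainConfig,
      (pinnedChain ω₂ lam β γ).IsChainGibbsMeasure T μ₁ → IsShiftInvariant μ₁ →
      (pinnedChain ω₂ lam β γ).HasSuperstabilityEstimate μ₁ →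
      (pinnedChain ω₂ lam β γ).IsChainGibbsMeasure T μ₂ → IsShiftInvariant μ₂ →
      (pinnedChain ω₂ lam β γ).HasSuperstabilityEstimate μ₂ → μ₁ = μ₂ :=
    fun μ₁ μ₂ h₁ hS₁ _ h₂ hS₂ _ =>
      OscillatorChain.eq_of_isChainGibbsMeasure_of_isShiftInvariant_pinnedChain γ hω hl.le hβ.le hT
        h₁ hS₁ h₂ hS₂
  have hrev : μ.map (fun σ : ChainConfig => fun x : ℤ => ((σ x).1, -(σ x).2)) = μ := by
    have h := OscillatorChain.map_momentumReversalZ_eq_of_regular_unique hG hS hss huniq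
    rw [coe_momentumReversalZ] at h
    exact h
  -- a.e. commutation with the unit shift
  have hshift : ∀ t : ℝ, ∀ᵐ σ ∂μ, D.flow t (shift σ) = shift (D.flow t σ) := by
    intro t
    filter_upwards [D.flow_comp_chainShift_ae_of_carrier_eq_bmGood hcar hU0 hV0 hD.1 t 1] with σ hσ
    rw [← chainShift_one]
    exact hσ
  refine ⟨μ, D, hG, hS, hrev, hcar.le, hD, hshift, fun t => ⟨fun x => ?_, ?_⟩⟩
  · exact OscillatorChain.hasAbsConvergentCorrelation_integrable_pinnedChain γ hω.le hl.le hβ hss D hD t x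
  · exact summable_abs_correlationTerm_of_carrier_eq_bmGood (by norm_num) (by norm_num) hU1 hV1 hG hS
      hss D hcar hD t

end Summit.AtomisticToContinuum.FouriersLaw.Theorems.NonBallistic

end
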